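import Mathlib.Analysis.Calculus.DifferentialForm.Basic
import Mathlib.Geometry.Manifold.MFDeriv.Atlas
import Mathlib.Geometry.Manifold.MFDeriv.SpecificFunctions
import Mathlib.Geometry.Manifold.VectorBundle.Tangent
import Mathlib.Topology.VectorBundle.ContinuousAlternatingMap
import Mathlib.Geometry.Manifold.ContMDiff.Defs
import Mathlib.LinearAlgebra.Quotient.Basic
import Summits.Ventures.HodgeRepro2.HostAPI.Util.ForallBinderLint

noncomputable section

open scoped Manifold ContDiff Topology
open Bundle Set

namespace HostAPI.Carriers.Geometry.Kaehler

variable {E : Type*} [NormedAddCommGroup E] [NormedSpace ℝ E]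
  {H : Type*} [TopologicalSpace H] (I : ModelWithCorners ℝ E H)
  (M : Type*) [TopologicalSpace M] [ChartedSpace H M]
  (F : Type*) [NormedAddCommGroup F] [NormedSpace ℝ F]

abbrev MForm (k : ℕ) : Type _ := (x : M) → TangentSpace I x [⋀^Fin k]→L[ℝ] F

variable {I M F} {k : ℕ}

namespace MForm

def inChart (α : MForm I M F k) (x₀ : M) : E → E [⋀^Fin k]→L[ℝ] F := fun y ↦
  (α ((extChartAt I x₀).symm y)).compContinuousLinearMap
    (mfderivWithin 𝓘(ℝ, E) I (extChartAt I x₀).symm (range I) y)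

@[simp]
theorem inChart_apply (α : MForm I M F k) (x₀ : M) (y : E) (v : Fin k → E) :
    α.inChart x₀ y v =
      α ((extChartAt I x₀).symm y)
        (fun i ↦ mfderivWithin 𝓘(ℝ, E) I (extChartAt I x₀).symm (range I) y (v i)) :=
  rfl

@[simp]
theorem inChart_add (α β : MForm I M F k) (x₀ : M) :
    (α + β).inChart x₀ = α.inChart x₀ + β.inChart x₀ :=
  rfl

@[simp]
theorem inChart_smul (c : ℝ) (α : MForm I M F k) (x₀ : M) :
    (c • α).inChart x₀ = c • α.inChart x₀ :=
  rfl

@[simp]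
theorem inChart_zero (x₀ : M) : (0 : MForm I M F k).inChart x₀ = 0 :=
  rfl

end MForm

def IsSmoothForm (α : MForm I M F k) : Prop :=
  ∀ x, ContDiffWithinAt ℝ ∞ (α.inChart x) (range I) (extChartAt I x x)

theorem isSmoothForm_zero : IsSmoothForm (0 : MForm I M F k) := fun x ↦ by
  rw [MForm.inChart_zero]
  exact contDiffWithinAt_const (c := 0)

theorem IsSmoothForm.add {α β : MForm I M F k} (hα : IsSmoothForm α) (hβ : IsSmoothForm β) :
    IsSmoothForm (α + β) := fun x ↦ by
  rw [MForm.inChart_add]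
  exact (hα x).add (hβ x)

theorem IsSmoothForm.smul (c : ℝ) {α : MForm I M F k} (hα : IsSmoothForm α) :
    IsSmoothForm (c • α) := fun x ↦ by
  rw [MForm.inChart_smul]
  exact (hα x).const_smul c

variable (I M F k) in

def smoothForms : Submodule ℝ (MForm I M F k) where
  carrier := {α | IsSmoothForm α}
  add_mem' hα hβ := hα.add hβ
  zero_mem' := isSmoothForm_zero
  smul_mem' c _ hα := hα.smul c

@[simp]
theorem mem_smoothForms_iff (α : MForm I M F k) : α ∈ smoothForms I M F k ↔ IsSmoothForm α :=
  Iff.rfl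

section Deriv

def mextDeriv (α : MForm I M F k) : MForm I M F (k + 1) := fun x ↦
  (extDerivWithin (α.inChart x) (range I) (extChartAt I x x)).compContinuousLinearMap
    (mfderiv I 𝓘(ℝ, E) (extChartAt I x) x)

def IsClosedForm (α : MForm I M F k) : Prop :=
  mextDeriv α = 0

theorem mextDeriv_add {α β : MForm I M F k} (hα : IsSmoothForm α) (hβ : IsSmoothForm β) :
    mextDeriv (α + β) = mextDeriv α + mextDeriv β := by
  funext x
  have hU : UniqueDiffWithinAt ℝ (range I) (extChartAt I x x) :=
    I.uniqueDiffOn _ (extChartAt_target_subset_range x (mem_extChartAt_target x))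
  simp only [mextDeriv, MForm.inChart_add]
  rw [extDerivWithin_add hU ((hα x).differentiableWithinAt (by simp))
    ((hβ x).differentiableWithinAt (by simp))]
  rfl

theorem mextDeriv_smul (c : ℝ) (α : MForm I M F k) : mextDeriv (c • α) = c • mextDeriv α := by
  funext x
  have hU : UniqueDiffWithinAt ℝ (range I) (extChartAt I x x) :=
    I.uniqueDiffOn _ (extChartAt_target_subset_range x (mem_extChartAt_target x))
  simp only [mextDeriv, MForm.inChart_smul]
  rw [extDerivWithin_smul c _ hU]
  rfl

@[simp]
theorem mextDeriv_zero : mextDeriv (0 : MForm I M F k) = 0 := by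
  simpa using mextDeriv_smul (0 : ℝ) (0 : MForm I M F k)

variable (I M F k) in

def closedSmoothForms : Submodule ℝ (MForm I M F k) where
  carrier := {α | IsSmoothForm α ∧ IsClosedForm α}
  add_mem' {α β} hα hβ := ⟨hα.1.add hβ.1, by
    rw [IsClosedForm, mextDeriv_add hα.1 hβ.1, hα.2, hβ.2, add_zero]⟩
  zero_mem' := ⟨isSmoothForm_zero, mextDeriv_zero⟩
  smul_mem' c α hα := ⟨hα.1.smul c, by rw [IsClosedForm, mextDeriv_smul, hα.2, smul_zero]⟩

@[simp]
theorem mem_closedSmoothForms_iff (α : MForm I M F k) :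
    α ∈ closedSmoothForms I M F k ↔ IsSmoothForm α ∧ IsClosedForm α :=
  Iff.rfl

variable (I M F) in

def exactSmoothForms : (k : ℕ) → Submodule ℝ (MForm I M F k)
  | 0 => ⊥
  | k + 1 => Submodule.span ℝ (mextDeriv '' (smoothForms I M F k : Set (MForm I M F k)))

variable (I M F k) in

def deRhamCohomology : Type _ :=
  ↥(closedSmoothForms I M F k) ⧸
    (exactSmoothForms I M F k).comap (closedSmoothForms I M F k).subtype

namespace deRhamCohomology

instance instAddCommGroup : AddCommGroup (deRhamCohomology I M F k) :=
  Submodule.Quotient.addCommGroup _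

instance instModule : Module ℝ (deRhamCohomology I M F k) :=
  Submodule.Quotient.module _

def mk : closedSmoothForms I M F k →ₗ[ℝ] deRhamCohomology I M F k :=
  Submodule.mkQ _

theorem mk_surjective : Function.Surjective (mk : closedSmoothForms I M F k → _) :=
  Submodule.mkQ_surjective _

theorem mk_eq_mk_iff (α β : closedSmoothForms I M F k) :
    mk α = mk β ↔ (α : MForm I M F k) - β ∈ exactSmoothForms I M F k :=
  (Submodule.Quotient.eq _).trans Iff.rfl

end deRhamCohomology

end Deriv

section Smooth

variable [IsManifold I ∞ M]

variable (I M F) in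

def isSmoothForm_iff_contMDiff_totalSpace : Prop :=
  ∀ [IsManifold I ∞ M] {k : ℕ} (α : MForm I M F k),
    IsSmoothForm α ↔
      ContMDiff I (I.prod 𝓘(ℝ, E [⋀^Fin k]→L[ℝ] F)) ∞
        (fun x ↦ TotalSpace.mk' (E [⋀^Fin k]→L[ℝ] F) x (α x))

variable (I M F) in

def inChart_mextDeriv : Prop :=
  ∀ [IsManifold I ∞ M] {k : ℕ} {α : MForm I M F k}, IsSmoothForm α → ∀ x₀ : M,
    ∀ᶠ y in 𝓝[range I] (extChartAt I x₀ x₀),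
      (mextDeriv α).inChart x₀ y = extDerivWithin (α.inChart x₀) (range I) y

theorem mextDeriv_mextDeriv (h : inChart_mextDeriv I M F) {α : MForm I M F k}
    (hα : IsSmoothForm α) : mextDeriv (mextDeriv α) = 0 := by
  funext x
  have hc : extChartAt I x x ∈ range I :=
    extChartAt_target_subset_range x (mem_extChartAt_target x)
  have h1 := Filter.EventuallyEq.extDerivWithin_eq_of_mem (h hα x) hc
  have hr : minSmoothness ℝ 2 ≤ ∞ := by
    rw [minSmoothness_of_isRCLikeNormedField]
    exact WithTop.coe_le_coe.2 le_top
  simp only [mextDeriv, h1]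
  rw [extDerivWithin_extDerivWithin_apply (hα x) hr I.uniqueDiffOn
    (I.range_subset_closure_interior hc) hc]
  rfl

theorem isSmoothForm_mextDeriv (h : inChart_mextDeriv I M F) {α : MForm I M F k}
    (hα : IsSmoothForm α) : IsSmoothForm (mextDeriv α) := by
  intro x
  have hc : extChartAt I x x ∈ range I :=
    extChartAt_target_subset_range x (mem_extChartAt_target x)
  have h2 : ContDiffWithinAt ℝ ∞ (extDerivWithin (α.inChart x) (range I)) (range I)
      (extChartAt I x x) := by
    have hf := (hα x).fderivWithin_right (m := ∞) I.uniqueDiffOn (by simp) hc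
    exact (ContinuousAlternatingMap.alternatizeUncurryFinCLM ℝ E F).contDiff.comp_contDiffWithinAt
      hf
  have hx := mem_of_mem_nhdsWithin hc (h hα x)
  exact h2.congr_of_eventuallyEq (h hα x) hx

variable (I M F) in

def mextDerivₗ (h : inChart_mextDeriv I M F) (k : ℕ) :
    smoothForms I M F k →ₗ[ℝ] smoothForms I M F (k + 1) where
  toFun α := ⟨mextDeriv (α : MForm I M F k), isSmoothForm_mextDeriv h α.2⟩
  map_add' α β := Subtype.ext (mextDeriv_add α.2 β.2)
  map_smul' c α := Subtype.ext (mextDeriv_smul c (α : MForm I M F k))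

@[simp]
theorem coe_mextDerivₗ_apply (h : inChart_mextDeriv I M F) (α : smoothForms I M F k) :
    (mextDerivₗ I M F h k α : MForm I M F (k + 1)) = mextDeriv (α : MForm I M F k) :=
  rfl

theorem exactSmoothForms_le_closedSmoothForms (h : inChart_mextDeriv I M F) :
    exactSmoothForms I M F k ≤ closedSmoothForms I M F k := by
  cases k with
  | zero => exact bot_le
  | succ k =>
    refine Submodule.span_le.2 ?_
    rintro _ ⟨α, hα, rfl⟩
    exact ⟨isSmoothForm_mextDeriv h hα, mextDeriv_mextDeriv h hα⟩

end Smooth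

section Flat

theorem mextDeriv_eq_extDeriv (α : MForm 𝓘(ℝ, E) E F k) (x : E) :
    mextDeriv α x = extDeriv α x := by
  have h : α.inChart x = α := by
    funext y
    ext v
    simp [MForm.inChart_apply]
    rfl
  ext v
  simp [mextDeriv, h, ContinuousAlternatingMap.compContinuousLinearMap_apply]
  rfl

end Flat

end HostAPI.Carriers.Geometry.Kaehler
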